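import Summits.KontsevichZagierPeriods.KontsevichZagierPeriods.Theorems.KzOnePeriodsG2SPhi2

/-!
# G2S derivations, part 11: lifting cycles of `E₂` through the second quotient `φ₂`

Sub-problem `KzOnePeriods` — the theorem of Huber–Wüstholz [cite: HuberWustholz2022, Thm 13.3 (2)
(p. 121)]: every `ℚ̄`-linear relation between 1-periods is a consequence of (R1) bilinearity,
(R2) forms vanishing on the curve, (R3) exactness, (R4) functoriality along morphisms of pairs and
(R5) homotopy [cite: HuberWustholz2022, §13.1 (A)–(B) (p. 120)].  Part 10 derived, for the even
sextic model `C_{a,b,c} : y² = f(x)` and its second quotient `φ₂ = (c/x² + b/3, c·y/x³) : C → E₂ =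
E_{A₂,B₂}`, the relation `(E₂, θ₀, φ₂∘γ) + 4·(C, θ_1, γ) ∈ ⟨(R1)–(R5)⟩_ℚ̄` for every path `γ` of `C`
avoiding `x = 0`.  kz1p's corpus (case G2-09) states its relations between a cycle `ε` OF THE FACTOR
`E₂` and a cycle of `C`; this part realises the cycle of `C` as the LIFT of `ε` through `φ₂`:

* `exists_liftPath2`: for real `b, c` and a path `δ = (X, Y)` on `E₂` with real first coordinate and
  `c/(X − b/3) > 0` on `[0, 1]`, the path `γ = (x, y)`, `x = ±√(c/(X − b/3))`, `y = Y x³/c`, lies on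
  `C_{a,b,c}` (`y² = x⁶ F₂(X)/c² = f(x)`), is `C¹` with algebraic end points, avoids `x = 0`, and
  `φ₂ ∘ γ = δ` on `[0, 1]`;
* `span_lift2` / `relation_lift2`: hence `(E₂, θ₀, δ) + 4·(C, θ_1, γ) ∈ ⟨(R1)–(R5)⟩_ℚ̄` and
  `∫_δ dX/Y = −4·∫_γ dx/2y` (part 10 `span_phi2`, `relation_phi2`).
For G2-09 (`f = (x²−1)(x²−4)(x²−11)`, `c = −44`, `b/3 = 59/3`): the imaginary oval `ε₂` of
`E₂′ : Y² = (X − 26/3)(X − 47/3)(X + 73/3)` over `[26/3, 47/3]` lifts with the sign `−` to kz1p's cycle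
`c₂₃⁻` over `x ∈ [−√11, −2]` (`c/(X − b/3) ∈ [4, 11]`), giving `∫_{ε₂} dX/Y = −4·∫_{c₂₃⁻} dx/2y`.

All statements quantify over `C¹` paths with algebraic end points (`CurvePath`).  No definitions
(local notation only), no new axioms; no statement of the programme is cited — the one citation is the
published theorem whose relation span is instantiated.
-/

noncomputable section

open MvPolynomial Set Complex Filter Topology
open Literature.NumberTheory.Transcendental Literature.NumberTheory.Transcendental.CurvePeriods
open Summit.KontsevichZagierPeriods.KzOnePeriods.E1Derivation

namespace Summit.KontsevichZagierPeriods.KzOnePeriods.G2SDerivation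

local notation3 "InSpanRel " c:arg => ∃ (k : ℕ) (ρ : Fin k → (PeriodSymbol →₀ ℂ))
  (a : Fin k → ℂ), (∀ l, IsElementaryRelation (ρ l)) ∧ (∀ l, IsAlgebraic ℚ (a l)) ∧
    c = ∑ l, a l • ρ l

/-- The symbol `(Z, ω, γ)` as an element of the formal period space. -/
local notation3 (prettyPrint := false) "Sy[" Z ", " hZ ", " ω ", " h ", " γ "]" =>
  (Finsupp.single (⟨Z, hZ, ω, h, γ⟩ : PeriodSymbol) (1 : ℂ) : PeriodSymbol →₀ ℂ)

/-- The period `∫_γ ω` of the symbol `(Z, ω, γ)`. -/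
local notation3 (prettyPrint := false) "Pe[" Z ", " hZ ", " ω ", " h ", " γ "]" =>
  PeriodSymbol.period (⟨Z, hZ, ω, h, γ⟩ : PeriodSymbol)

/-- The even sextic `f = x⁶ + a x⁴ + b x² + c ∈ ℂ[x, y]`. -/
local notation3 (prettyPrint := false) "fS[" a ", " b ", " c "]" =>
  ((X 0 : MvPolynomial (Fin 2) ℂ) ^ 6 + C a * X 0 ^ 4 + C b * X 0 ^ 2 + C c)

/-- The affine plane model `C_{a,b,c} = {y² = f(x)} ⊂ 𝔸²`. -/
local notation3 (prettyPrint := false) "Cpl[" a ", " b ", " c "]" =>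
  (⟨2, 1, ![(X 1 : MvPolynomial (Fin 2) ℂ) ^ 2 - fS[a, b, c]]⟩ : CurveData)

/-- The polynomial `Σ_k π_k x^k ∈ ℂ[x, y]` with coefficient vector `π`. -/
local notation3 (prettyPrint := false) "Pol[" π "]" =>
  (∑ k, C (π k) * (X 0 : MvPolynomial (Fin 2) ℂ) ^ (k : ℕ))

/-- The even polynomial `U = Σ_{k<3} μ_k x^{2k}` (Bézout cofactor of `f`). -/
local notation3 (prettyPrint := false) "Upol[" μ "]" =>
  (∑ k : Fin 3, C (μ k) * (X 0 : MvPolynomial (Fin 2) ℂ) ^ (2 * (k : ℕ)))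

/-- The odd polynomial `V = Σ_{k<3} ν_k x^{2k+1}` (Bézout cofactor of `f′`). -/
local notation3 (prettyPrint := false) "Vpol[" ν "]" =>
  (∑ k : Fin 3, C (ν k) * (X 0 : MvPolynomial (Fin 2) ℂ) ^ (2 * (k : ℕ) + 1))

/-- `θ[μ, ν, π] = (½ P U y) dx + (P V) dy`, the polynomial representative of `P(x) dx/(2y)`. -/
local notation3 (prettyPrint := false) "θ[" μ ", " ν ", " π "]" =>
  (![C (1 / 2 : ℂ) * Pol[π] * Upol[μ] * X 1, Pol[π] * Vpol[ν]] :
    Fin 2 → MvPolynomial (Fin 2) ℂ)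

/-- The Bézout identity `U f + V f′ = 1` (scalar form). -/
local notation3 (prettyPrint := false) "Bez[" a ", " b ", " c ", " μ ", " ν "]" =>
  (∀ x : ℂ, (∑ k : Fin 3, μ k * x ^ (2 * (k : ℕ))) * (x ^ 6 + a * x ^ 4 + b * x ^ 2 + c) +
    (∑ k : Fin 3, ν k * x ^ (2 * (k : ℕ) + 1)) * (6 * x ^ 5 + 4 * a * x ^ 3 + 2 * b * x) = 1)

/-- `P = 1` (scalar form): `θ[μ, ν, π]` is then `θ_1`, the representative of `dx/(2y)`. -/
local notation3 (prettyPrint := false) "IsOne[" π "]" => (∀ x : ℂ, ∑ k, π k * x ^ (k : ℕ) = 1)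

/-- `f(x) = x⁶ F(c/x² + b/3)/c²` with `F = X³ + AX + B`: the coefficients of the second quotient. -/
local notation3 (prettyPrint := false) "SplitR[" a ", " b ", " c ", " A ", " B "]" =>
  ((A : ℂ) = a * c - b ^ 2 / 3 ∧ (B : ℂ) = c ^ 2 - a * b * c / 3 + 2 * b ^ 3 / 27)

variable {a b c : ℂ}

/-- **The lift through `φ₂`.**  Let `b, c` be real algebraic, `f(x) = x⁶F(c/x² + b/3)/c²` (`SplitR`),
and let `δ = (X, Y)` be a path on `E_{A,B}` with real first coordinate and `c/(X − b/3) > 0` on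
`[0, 1]`.  For a sign `s = ±1`, the path `γ = (x, y)` with `x = s·√(c/(X − b/3))` (real, `≠ 0`) and
`y = Y x³/c` lies on `C_{a,b,c}`, is `C¹` with algebraic end points, and `φ₂ ∘ γ = (c/x² + b/3,
c y/x³) = δ` on `[0, 1]`. -/
theorem exists_liftPath2 {A B : ℂ} {br cr : ℝ} (hbr : b = (br : ℂ)) (hcr : c = (cr : ℂ))
    (hb : IsAlgebraic ℚ b) (hc : IsAlgebraic ℚ c) (hsp : SplitR[a, b, c, A, B]) {xs : ℝ}
    (hxs : xs = 1 ∨ xs = -1) {X : ℝ → ℝ} {Yc : ℝ → ℂ} {δ : CurvePath (weierCurve A B)}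
    (hδ : ∀ t, δ.toFun t = ![(X t : ℂ), Yc t])
    (hpos : ∀ t ∈ Icc (0 : ℝ) 1, 0 < cr / (X t - br / 3)) :
    ∃ γ : CurvePath Cpl[a, b, c],
      (∀ t, γ.toFun t = ![((xs * √(cr / (X t - br / 3)) : ℝ) : ℂ),
        Yc t * ((xs * √(cr / (X t - br / 3)) : ℝ) : ℂ) ^ 3 / c]) ∧
      (∀ t ∈ Icc (0 : ℝ) 1, γ.toFun t 0 ≠ 0) ∧
      ∀ t ∈ Icc (0 : ℝ) 1, δ.toFun t =
        ![c * (γ.toFun t 0)⁻¹ ^ 2 + b / 3, c * γ.toFun t 1 * (γ.toFun t 0)⁻¹ ^ 3] := by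
  obtain ⟨hA, hB⟩ := hsp
  have hI0 : (0 : ℝ) ∈ Icc (0 : ℝ) 1 := ⟨le_rfl, zero_le_one⟩
  have hI1 : (1 : ℝ) ∈ Icc (0 : ℝ) 1 := ⟨zero_le_one, le_rfl⟩
  have hxs2 : xs ^ 2 = 1 := by rcases hxs with rfl | rfl <;> norm_num
  have hxsa : IsAlgebraic ℚ (xs : ℂ) := by
    rcases hxs with rfl | rfl
    · simpa using isAlgebraic_one (R := ℚ) (A := ℂ)
    · simpa using (isAlgebraic_one (R := ℚ) (A := ℂ)).neg
  have hδ0 : ∀ t, δ.toFun t 0 = (X t : ℂ) := fun t => by rw [hδ]; rfl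
  have hδ1 : ∀ t, δ.toFun t 1 = Yc t := fun t => by rw [hδ]; rfl
  have hXr : ContDiffOn ℝ 1 X (Icc 0 1) := contDiffOn_realCoord δ hδ0
  have hYC : ContDiffOn ℝ 1 Yc (Icc 0 1) :=
    ((contDiffOn_pi.1 δ.contDiffOn) 1).congr fun t _ => (hδ1 t).symm
  -- non-vanishing of `X − b/3` and `c`
  have hW : ∀ t ∈ Icc (0 : ℝ) 1, X t - br / 3 ≠ 0 := fun t ht h => by
    have := hpos t ht; rw [h, div_zero] at this; exact lt_irrefl _ this
  have hcr0 : cr ≠ 0 := fun h => by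
    have := hpos 0 hI0; rw [h, zero_div] at this; exact lt_irrefl _ this
  have hc0 : c ≠ 0 := by rw [hcr]; exact_mod_cast hcr0
  -- the radicand and the real coordinate `x`
  have hρC : ContDiffOn ℝ 1 (fun t => cr / (X t - br / 3)) (Icc 0 1) :=
    contDiffOn_const.div (hXr.sub contDiffOn_const) hW
  have hxR : ContDiffOn ℝ 1 (fun t => xs * √(cr / (X t - br / 3))) (Icc 0 1) :=
    contDiffOn_const.mul (hρC.sqrt fun t ht => (hpos t ht).ne')
  have hxC : ContDiffOn ℝ 1 (fun t => (((xs * √(cr / (X t - br / 3))) : ℝ) : ℂ)) (Icc 0 1) :=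
    (Complex.ofRealCLM.contDiff.comp_contDiffOn hxR).congr fun t _ => by simp
  -- `x² (X − b/3) = c` on `[0, 1]`
  have hx2r : ∀ t ∈ Icc (0 : ℝ) 1, (xs * √(cr / (X t - br / 3))) ^ 2 * (X t - br / 3) = cr := by
    intro t ht
    rw [mul_pow, hxs2, one_mul, Real.sq_sqrt (hpos t ht).le]
    exact div_mul_cancel₀ _ (hW t ht)
  have hx2 : ∀ t ∈ Icc (0 : ℝ) 1,
      (((xs * √(cr / (X t - br / 3))) : ℝ) : ℂ) ^ 2 * ((X t : ℂ) - b / 3) = c := by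
    intro t ht
    rw [hbr, hcr]
    exact_mod_cast hx2r t ht
  have hxne : ∀ t ∈ Icc (0 : ℝ) 1, (((xs * √(cr / (X t - br / 3))) : ℝ) : ℂ) ≠ 0 := by
    intro t ht h
    have := hx2 t ht
    rw [h, zero_pow two_ne_zero, zero_mul] at this
    exact hc0 this.symm
  -- `δ` lies on `E`
  have hmemE : ∀ t ∈ Icc (0 : ℝ) 1, Yc t ^ 2 = (X t : ℂ) ^ 3 + A * X t + B := fun t ht => by
    have h := δ.mem_points t ht
    rw [Weier.mem_points_iff, Weier.eval_fPoly, hδ] at h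
    simpa using h
  -- algebraic end points
  have halg : ∀ {t}, t ∈ Icc (0 : ℝ) 1 → (∀ i, IsAlgebraic ℚ (δ.toFun t i)) →
      ∀ i, IsAlgebraic ℚ ((![(((xs * √(cr / (X t - br / 3))) : ℝ) : ℂ),
        Yc t * (((xs * √(cr / (X t - br / 3))) : ℝ) : ℂ) ^ 3 / c] : Fin 2 → ℂ) i) := by
    intro t ht hal
    have hρa : IsAlgebraic ℚ (((cr / (X t - br / 3) : ℝ)) : ℂ) := by
      have e : (((cr / (X t - br / 3) : ℝ)) : ℂ) = c * ((δ.toFun t 0) - b / 3)⁻¹ := by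
        rw [hδ0, hbr, hcr, ← div_eq_mul_inv]; push_cast; ring
      rw [e]
      exact hc.mul ((hal 0).sub (by
        rw [div_eq_mul_inv]; exact hb.mul (isAlgebraic_nat 3).inv)).inv
    have hxa : IsAlgebraic ℚ ((((xs * √(cr / (X t - br / 3))) : ℝ) : ℂ)) := by
      rw [ofReal_mul]
      exact hxsa.mul (isAlgebraic_sqrt (hpos t ht).le hρa)
    intro i
    fin_cases i
    · simpa using hxa
    · have hy : IsAlgebraic ℚ (Yc t * (((xs * √(cr / (X t - br / 3))) : ℝ) : ℂ) ^ 3 / c) := by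
        rw [div_eq_mul_inv, ← hδ1 t]
        exact ((hal 1).mul (hxa.pow 3)).mul hc.inv
      simpa using hy
  refine ⟨{ toFun := fun t => ![(((xs * √(cr / (X t - br / 3))) : ℝ) : ℂ),
              Yc t * (((xs * √(cr / (X t - br / 3))) : ℝ) : ℂ) ^ 3 / c]
            contDiffOn := ?_
            mem_points := ?_
            algebraic_zero := halg hI0 δ.algebraic_zero
            algebraic_one := halg hI1 δ.algebraic_one }, fun t => rfl,
    fun t ht => by simpa using hxne t ht, fun t ht => ?_⟩
  · rw [contDiffOn_pi]
    intro j
    fin_cases j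
    · exact hxC
    · exact (hYC.mul (hxC.pow 3)).div_const c
  · intro t ht
    rw [mem_points_iff]
    simp only [Matrix.cons_val_zero, Matrix.cons_val_one]
    have hE := hmemE t ht
    rw [hA, hB] at hE
    have hT : c * c⁻¹ = 1 := mul_inv_cancel₀ hc0
    have hX2 := hx2 t ht
    set x : ℂ := (((xs * √(cr / (X t - br / 3))) : ℝ) : ℂ) with hxdef
    linear_combination (c⁻¹ ^ 2 * x ^ 6) * hE +
      (c⁻¹ ^ 2 * (((X t : ℂ) - b / 3) ^ 2 * x ^ 4 + c * ((X t : ℂ) - b / 3) * x ^ 2 + c ^ 2 +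
        b * (((X t : ℂ) - b / 3) * x ^ 2 + c) * x ^ 2 + a * c * x ^ 4)) * hX2 +
      ((c * c⁻¹ + 1) * (x ^ 6 + a * x ^ 4 + b * x ^ 2 + c)) * hT
  · -- `φ₂ ∘ γ = δ`
    have hx := hxne t ht
    have hX2 := hx2 t ht
    set x : ℂ := (((xs * √(cr / (X t - br / 3))) : ℝ) : ℂ) with hxdef
    have hWx : (X t : ℂ) - b / 3 = c / x ^ 2 :=
      eq_div_of_mul_eq (pow_ne_zero 2 hx) (by rw [mul_comm]; exact hX2)
    have e0 : (X t : ℂ) = c * x⁻¹ ^ 2 + b / 3 := by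
      rw [inv_pow, ← div_eq_mul_inv, ← hWx]; ring
    have e1 : c * (Yc t * x ^ 3 / c) * x⁻¹ ^ 3 = Yc t := by
      field_simp
    rw [hδ]
    simp only [Matrix.cons_val_zero, Matrix.cons_val_one]
    rw [e1, ← e0]

/-- **`(E₂, θ₀, δ) + 4·(C, θ_1, γ) ∈ ⟨(R1)–(R5)⟩_ℚ̄` for the lift `γ` of `δ` through `φ₂`** (part 10
`span_phi2` on the lift of `exists_liftPath2`). -/
theorem span_lift2 (ha : IsAlgebraic ℚ a) (hb : IsAlgebraic ℚ b) (hc : IsAlgebraic ℚ c)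
    {μ ν : Fin 3 → ℂ} (hμ : ∀ k, IsAlgebraic ℚ (μ k)) (hν : ∀ k, IsAlgebraic ℚ (ν k))
    (hbez : Bez[a, b, c, μ, ν]) {N : ℕ} {π : Fin N → ℂ} (hπa : ∀ k, IsAlgebraic ℚ (π k))
    (hπ : IsOne[π]) {A B : ℂ} (hA : IsAlgebraic ℚ A) (hB : IsAlgebraic ℚ B)
    (hD : Weier.disc A B ≠ 0) (hsp : SplitR[a, b, c, A, B]) {br cr : ℝ} (hbr : b = (br : ℂ))
    (hcr : c = (cr : ℂ)) {xs : ℝ} (hxs : xs = 1 ∨ xs = -1) {X : ℝ → ℝ} {Yc : ℝ → ℂ}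
    {δ : CurvePath (weierCurve A B)} (hδ : ∀ t, δ.toFun t = ![(X t : ℂ), Yc t])
    (hpos : ∀ t ∈ Icc (0 : ℝ) 1, 0 < cr / (X t - br / 3)) :
    ∃ γ : CurvePath Cpl[a, b, c],
      (∀ t, γ.toFun t = ![((xs * √(cr / (X t - br / 3)) : ℝ) : ℂ),
        Yc t * ((xs * √(cr / (X t - br / 3)) : ℝ) : ℂ) ^ 3 / c]) ∧
      InSpanRel (Sy[weierCurve A B, Weier.isSmoothAffineCurve A B hA hB hD, Weier.theta0 A B,
          Weier.hasAlgCoeffs_theta0 A B hA hB, δ] -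
        (-4 : ℂ) • Sy[Cpl[a, b, c], smooth ha hb hc hbez, θ[μ, ν, π], hasAlgCoeffs_theta hμ hν hπa, γ]) := by
  obtain ⟨γ, hγ, h0, hφ⟩ := exists_liftPath2 hbr hcr hb hc hsp hxs hδ hpos
  exact ⟨γ, hγ, span_phi2 ha hb hc hμ hν hbez hπa hπ hA hB hD hsp h0 hφ⟩

/-- **`∫_δ dX/Y = −4·∫_γ dx/2y` for the lift `γ` of `δ` through `φ₂`** (part 10 `relation_phi2`). -/
theorem relation_lift2 (ha : IsAlgebraic ℚ a) (hb : IsAlgebraic ℚ b) (hc : IsAlgebraic ℚ c)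
    {μ ν : Fin 3 → ℂ} (hμ : ∀ k, IsAlgebraic ℚ (μ k)) (hν : ∀ k, IsAlgebraic ℚ (ν k))
    (hbez : Bez[a, b, c, μ, ν]) {N : ℕ} {π : Fin N → ℂ} (hπa : ∀ k, IsAlgebraic ℚ (π k))
    (hπ : IsOne[π]) {A B : ℂ} (hA : IsAlgebraic ℚ A) (hB : IsAlgebraic ℚ B)
    (hD : Weier.disc A B ≠ 0) (hsp : SplitR[a, b, c, A, B]) {br cr : ℝ} (hbr : b = (br : ℂ))
    (hcr : c = (cr : ℂ)) {xs : ℝ} (hxs : xs = 1 ∨ xs = -1) {X : ℝ → ℝ} {Yc : ℝ → ℂ}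
    {δ : CurvePath (weierCurve A B)} (hδ : ∀ t, δ.toFun t = ![(X t : ℂ), Yc t])
    (hpos : ∀ t ∈ Icc (0 : ℝ) 1, 0 < cr / (X t - br / 3)) :
    ∃ γ : CurvePath Cpl[a, b, c],
      (∀ t, γ.toFun t = ![((xs * √(cr / (X t - br / 3)) : ℝ) : ℂ),
        Yc t * ((xs * √(cr / (X t - br / 3)) : ℝ) : ℂ) ^ 3 / c]) ∧
      Pe[weierCurve A B, Weier.isSmoothAffineCurve A B hA hB hD, Weier.theta0 A B,
          Weier.hasAlgCoeffs_theta0 A B hA hB, δ] =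
        -4 * Pe[Cpl[a, b, c], smooth ha hb hc hbez, θ[μ, ν, π], hasAlgCoeffs_theta hμ hν hπa, γ] := by
  obtain ⟨γ, hγ, h0, hφ⟩ := exists_liftPath2 hbr hcr hb hc hsp hxs hδ hpos
  exact ⟨γ, hγ, relation_phi2 ha hb hc hμ hν hbez hπa hπ hA hB hD hsp h0 hφ⟩

end Summit.KontsevichZagierPeriods.KzOnePeriods.G2SDerivation

end
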